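import Mathlib
import Summits.NavierStokesRegularity.NavierStokesRegularity.Theses.FilamentSkeletonRss
import Summits.NavierStokesRegularity.NavierStokesRegularity.Theorems.FilamentSkeletonRssCoreGluingSplit
import Summits.NavierStokesRegularity.NavierStokesRegularity.Theorems.FilamentSkeletonRssCoreLinearInvertibility

/-!
# Route FilamentSkeletonRss · crux `CoreGluing` (stmt-NavierStokesRegularity-15401) — line `invertibility-split`, RESHAPE 3 (lead c13, route rev 9), self-contained registration copy

`CoreGluing := SkeletonEquilibrium → RssProfileExists` — held `support` item since the 16:59Z retriage; parent of the
rev-9 cone `SelectionBoxR` (stmt-19174) · `CoreLinearInvertibility` (stmt-17973, PROVED p171932) ·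
`CoreGluingGivenInvertibilityQR` (stmt-19176) · `BoxSelectionR` (stmt-19177, glue) · `RdssProfileTruncation` (stmt-11289, proved).

Reshape 3 (rev 9, 2026-08-17T18:22Z): `TransverseReduction` (stmt-18688) was refuted-MISSTATED by the far-field circulation
law (axis-parallel stagnation cores have accretion scalar ≡ 0) and the planners restated BOTH quantitative children with a
tilt/parameter margin `θ₀` — `SelectionBoxR` (19174), `TransverseReductionR` (19175), `CoreGluingGivenInvertibilityQR :=
CoreLinearInvertibility → TransverseReductionR` (19176) — retiring the rev-8 decls of reshape 2.  Stubs = the two open rev-9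
crux decls BY NAME; composition = the selection glue of p153006 (Poincaré–Miranda on the accretion sign law) re-threaded
through `θ₀`, fed with the PROVED linear input `coreLinearInvertibility_proof`.  The glue is inlined here
(`skel_rssProfileExists_of_selectionBoxR_transverseReductionR`) so that the skeleton registers over tree imports only; its tree
copy is `Theorems/FilamentSkeletonRssCoreGluingSplitR.lean` (`rssProfileExists_of_selectionBoxR_transverseReductionR`, lead c13).
Other closing recipes (landed): `coreGluing_of_not_skeletonEquilibrium` (p140859) if stmt-15400 is refuted;
`stub_rssProfileExists_of_profile` (p130189) from one smooth decaying rotated-Leray profile.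
-/

set_option linter.dupNamespace false

noncomputable section

namespace Summit.NavierStokesRegularity.NavierStokesRegularity.Theorems

open Set Function Filter MeasureTheory Real
open Literature.Analysis.FluidPDE Literature.Analysis.FluidPDE.PineauVicol2026
open Summit.NavierStokesRegularity.NavierStokesRegularity.Theses.FilamentSkeletonRss
open scoped RealInnerProductSpace Laplacian ContDiff Topology

/-- **Stub 1 = route item stmt-NavierStokesRegularity-19174 (`SelectionBoxR`), by name.**  The ball-exact
N-parameter box of TILTED, parameter-bounded skeletons (exact tangency on `‖X‖ ≤ Rb√(Γ log Γ)`, waist, tilt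
`|⟪X′_j(c_j), e₃⟫| ≤ 1 − θ₀`, bounds `θ₀ ≤ |α|, |γ_j| ≤ θ₀⁻¹`, unique supercritical zero with slope window, quantitative
geometry, Hurwitz transverse block, weighted injectivity mod rotation) for all `Γ ≥ Γ₂`, plus the accretion sign law. -/
theorem stub_selectionBoxR : SelectionBoxR := by
  sorry

/-- **Stub 2 = route item stmt-NavierStokesRegularity-19176 (`CoreGluingGivenInvertibilityQR`), by name.**
`CoreLinearInvertibility → TransverseReductionR`: the 3-D viscous gluing of Burgers-type cores onto every tilted
ball-exact skeleton box modulo the N accretion modes, given the planar linear input — a theorem (p171932), so this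
stub is `TransverseReductionR` (stmt-19175) up to modus ponens. -/
theorem stub_coreGluingGivenInvertibilityQR : CoreGluingGivenInvertibilityQR := by
  sorry

/-- **Selection glue on the repaired children** (inlined registration copy of
`Theorems.rssProfileExists_of_selectionBoxR_transverseReductionR`): `SelectionBoxR → TransverseReductionR → RssProfileExists`
— box at `Γ = max Γ₁ Γ₂` ⇒ reduced family `(U,P,B)` ⇒ opposite face signs ⇒ Poincaré–Miranda zero `p⋆` of the
sign-normalised accretion map (`stub_poincareMiranda`, p139006) ⇒ exact profile `U_{p⋆}` ⇒ `stub_rssProfileExists_of_profile`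
(p130189). [folklore] -/
theorem skel_rssProfileExists_of_selectionBoxR_transverseReductionR (hbox : SelectionBoxR)
    (hred : TransverseReductionR) : RssProfileExists := by
  classical
  obtain ⟨N, δ, ρ, K, Λ, a, b, cnd, η, Rw, Rb, cg, θ₀, Γ₂, hN, hδ, hρ, _hcnd, hη, hRw, hRb, hcg, hθ₀, hbox⟩ :=
    hbox
  obtain ⟨Γ₁, hred⟩ := hred N δ ρ K Λ a b cnd η Rw Rb cg θ₀ hN hδ hρ hη hRw hRb hcg hθ₀
  obtain ⟨γ, α, X, w, c, m, n, hfam⟩ := hbox (max Γ₁ Γ₂) (le_max_right _ _)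
  -- the derived objects of the skeleton box at circulation `Γ = max Γ₁ Γ₂`
  set Γ : ℝ := max Γ₁ Γ₂
  set u : (Fin N → ℝ) → (Fin N → ℝ → EuclideanSpace ℝ (Fin 3)) → EuclideanSpace ℝ (Fin 3) →
      EuclideanSpace ℝ (Fin 3) := fun p Z y => ∑ k : Fin N, (Γ * γ p k / (4 * π)) • ∫ σ : ℝ,
        ((‖y - Z k σ‖ ^ 2 + 1) ^ (3 / 2 : ℝ))⁻¹ • cross (deriv (Z k) σ) (y - Z k σ)
  set v : (Fin N → ℝ) → EuclideanSpace ℝ (Fin 3) → EuclideanSpace ℝ (Fin 3) :=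
    fun p y => u p (X p) y + (1 / 2 : ℝ) • y - α p • cross (EuclideanSpace.single (2 : Fin 3) (1 : ℝ)) y
  set A : (Fin N → ℝ) → Fin N → (EuclideanSpace ℝ (Fin 3) →L[ℝ] EuclideanSpace ℝ (Fin 3)) :=
    fun p j => fderiv ℝ (v p) (X p j (c p j))
  set T : (Fin N → ℝ) → (Fin N → ℝ → EuclideanSpace ℝ (Fin 3)) → Fin N → ℝ →
      EuclideanSpace ℝ (Fin 3) :=
    fun p Z j τ => (u p Z (Z j τ) + (1 / 2 : ℝ) • Z j τ - α p • cross (EuclideanSpace.single (2 : Fin 3) (1 : ℝ)) (Z j τ)) -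
      (inner ℝ (u p Z (Z j τ) + (1 / 2 : ℝ) • Z j τ - α p • cross (EuclideanSpace.single (2 : Fin 3) (1 : ℝ)) (Z j τ)) (deriv (Z j) τ) /
        ‖deriv (Z j) τ‖ ^ 2) • deriv (Z j) τ
  set D : (Fin N → ℝ) → Fin N → EuclideanSpace ℝ (Fin 3) → EuclideanSpace ℝ (Fin 3) :=
    fun p j y => (Real.exp (-(inner ℝ (y - X p j (c p j)) (deriv (X p j) (c p j))) ^ 2) *
      ((1 - Real.exp (-(‖y - X p j (c p j)‖ ^ 2 -
        inner ℝ (y - X p j (c p j)) (deriv (X p j) (c p j)) ^ 2))) /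
        (‖y - X p j (c p j)‖ ^ 2 - inner ℝ (y - X p j (c p j)) (deriv (X p j) (c p j)) ^ 2))) •
      cross (deriv (X p j) (c p j)) (y - X p j (c p j))
  obtain ⟨⟨hcont, hskel⟩, hsign⟩ := hfam u v A T D (fun _ _ _ => rfl) (fun _ _ => rfl)
    (fun _ _ => rfl) (fun _ _ _ _ => rfl) (fun _ _ _ => rfl)
  obtain ⟨C₀, M, U, P, B, hUPB⟩ := hred Γ (le_max_left _ _) γ α X w c m n u v A T D
    (fun _ _ _ => rfl) (fun _ _ => rfl) (fun _ _ => rfl) (fun _ _ _ _ => rfl) (fun _ _ _ => rfl)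
    ⟨hcont, hskel⟩
  have hs := hsign C₀ M U P B hUPB
  obtain ⟨hBcont, hfamU⟩ := hUPB
  -- the corner `(1,…,1)` and the face points `(1,…,0,…,1)`
  set one : Fin N → ℝ := fun _ => 1
  have hone_mem : ∀ i, one i ∈ Icc (0:ℝ) 1 := fun _ => ⟨zero_le_one, le_rfl⟩
  have hupd_mem : ∀ j i, Function.update one j 0 i ∈ Icc (0:ℝ) 1 := by
    intro j i
    rcases eq_or_ne i j with rfl | h
    · simp
    · rw [Function.update_of_ne h]; exact hone_mem i
  -- `B one j ≠ 0`, and the signs on the two faces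
  have hface0 : ∀ j (p : Fin N → ℝ), (∀ i, p i ∈ Icc (0:ℝ) 1) → p j = 0 → B p j * B one j < 0 :=
    fun j p hp hpj => hs j p one hp hone_mem hpj rfl
  have hone_ne : ∀ j, B one j ≠ 0 := by
    intro j h0
    have := hface0 j (Function.update one j 0) (hupd_mem j) (by simp)
    rw [h0, mul_zero] at this
    exact lt_irrefl _ this
  have hface1 : ∀ j (q : Fin N → ℝ), (∀ i, q i ∈ Icc (0:ℝ) 1) → q j = 1 → 0 < B one j * B q j := by
    intro j q hq hqj
    have h1 : B (Function.update one j 0) j * B q j < 0 :=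
      hs j (Function.update one j 0) q (hupd_mem j) hq (by simp) hqj
    have h2 : B (Function.update one j 0) j * B one j < 0 :=
      hface0 j (Function.update one j 0) (hupd_mem j) (by simp)
    rcases mul_neg_iff.1 h1 with ⟨ha, hb⟩ | ⟨ha, hb⟩
    · rcases mul_neg_iff.1 h2 with ⟨_, hb'⟩ | ⟨ha', _⟩
      · exact mul_pos_of_neg_of_neg hb' hb
      · exact absurd ha (not_lt.2 ha'.le)
    · rcases mul_neg_iff.1 h2 with ⟨ha', _⟩ | ⟨_, hb'⟩
      · exact absurd ha (not_lt.2 ha'.le)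
      · exact mul_pos hb' hb
  -- the sign-normalised accretion map and Poincaré–Miranda
  set f : (Fin N → ℝ) → Fin N → ℝ := fun p j => B one j * B p j
  have hfcont : ContinuousOn f {p : Fin N → ℝ | ∀ i, p i ∈ Icc (0:ℝ) 1} :=
    continuousOn_pi.2 fun j => continuousOn_const.mul ((continuousOn_pi.1 hBcont) j)
  obtain ⟨ps, hps, hzero⟩ := stub_poincareMiranda N f hfcont
    (fun p hp j hpj => by
      have := hface0 j p hp hpj
      show B one j * B p j ≤ 0
      rw [mul_comm]; exact this.le)
    (fun q hq j hqj => (hface1 j q hq hqj).le)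
  have hB0 : ∀ j, B ps j = 0 := fun j =>
    (mul_eq_zero.1 (hzero j)).resolve_left (hone_ne j)
  -- the selected member of the reduced family is an exact profile
  obtain ⟨hU0, hUs, hPs, hdiv, heq, hdec, hPM, -⟩ := hfamU ps hps
  have heq0 : ∀ y : EuclideanSpace ℝ (Fin 3), α ps • (rotGen (U ps y) - fderiv ℝ (U ps) y (rotGen y)) +
      (1 / 2 : ℝ) • U ps y + (1 / 2 : ℝ) • fderiv ℝ (U ps) y y - (Δ (U ps)) y +
      fderiv ℝ (U ps) y (U ps y) + gradient (P ps) y = 0 := by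
    intro y
    simp only [splitGlue_rotGen_eq_cross_single_two]
    rw [heq y]
    simp [hB0]
  exact stub_rssProfileExists_of_profile
    ⟨α ps, C₀, M, U ps, P ps, (hskel ps hps).1, hU0, hUs, hPs, hdiv, heq0, hdec, hPM⟩

/-- **Composition.**  The crux `CoreGluing` BY NAME from the two stubs and the proved linear input
(`coreLinearInvertibility_proof`, p171932); the hypothesis `SkeletonEquilibrium` is not consumed. -/
theorem CoreGluing_of : CoreGluing :=
  fun _ => skel_rssProfileExists_of_selectionBoxR_transverseReductionR stub_selectionBoxR
    (stub_coreGluingGivenInvertibilityQR coreLinearInvertibility_proof)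

end Summit.NavierStokesRegularity.NavierStokesRegularity.Theorems

end
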